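import Summits.QuantumFields.YangMills.Theorems.BalabanLadderNTBoundaryLawCentred
import Summits.Ventures.YMGap.Thresholds.StrongCouplingAllGroups
import Literature.Probability.LatticeModels.DobrushinComparisonBoundarySet
import HarnessLib

/-!
# Crux `NT` (stmt-QuantumFields-19353) / seam `UVSeamRec` (stmt-QuantumFields-20043): boundary influence on ARBITRARY
# finite volumes at strong coupling — the general-volume Dobrushin engine behind the E1/E2/E3-osc format rungs

Helper file of the fleet lead prover of crux `NT` (unit `ym-spine-19353-p1`, g6).  The sibling file
`…NTBoundaryLawStrongCoupling` proved the ∀-exterior ONE-point law (E1-osc, `RefPkgT` clause 1) at strong coupling on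
CUBES through the cube-based Dobrushin–Shlosman recursion.  The two- and three-point ceilings of the registered package
(E2-osc: decay in min-depth × SEPARATION; E3-osc) need decay of boundary influence for ARBITRARY sub-volumes of a cube (the
conditional law of one insertion given the rest lives on a non-cubical volume hugging the cube's faces), which the cube
machinery does not give.  This file supplies it from the tree's general-volume Dobrushin comparison theorem (Georgii 2011
Thm. 8.20 = `DobrushinMetric.abs_kernel_sub_le_of_superSolution_of_ne`) fed with the every-group total-variation Dobrushin
condition of the Wilson specification (`StrongCouplingAllGroups.isKRContraction_ymSpecification_osc`: influence coefficient
`6 N |β|` per plaquette neighbour in `d = 4`, row sums `≤ 108 N |β|`) and PROFILE SUPERSOLUTIONS `q^{ℓ}`: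

* `sum_mul_pow_profile_le` — generic: if the row sums of Dobrushin's matrix are `≤ α ≤ q ≤ 1` (`0 < q`) and `ℓ` is
  `1`-Lipschitz along the interaction graph (`ℓ x ≤ ℓ z + 1` for `z ∈ nbr x`), then `z ↦ q^{ℓ z}` is a super-solution
  (`Σ_{z ∈ nbr x} C_{xz} q^{ℓ z} ≤ q^{ℓ x}`);
* `abs_kerInt_sub_le_of_profile` — **general-volume influence at strong coupling**: for a lattice representation `r` of a
  compact metrisable `G` and `216 · N · |β| ≤ 1` (`N = r.N`; Dobrushin row sum `≤ 1/2 =: q`), EVERY finite link set `Λ`,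
  EVERY two exteriors `ω, η`, every `1`-Lipschitz profile `ℓ : links → ℕ` VANISHING wherever `ω ≠ η` off `Λ`, and every
  bounded measurable `f` (`|f| ≤ M`) depending on the finite link set `Δ`:
  `|∫ f dγ_Λ(·|ω) − ∫ f dγ_Λ(·|η)| ≤ 2M · Σ_{z ∈ Δ} 2^{−ℓ z}`;
* two profiles on `ℤ⁴`: the BALL profile `(m + 1) − ⌊‖z − y‖_∞⌋` (`ballProfile_lipschitz`) and, for a cube `Q = (c, b)`,
  the DEPTH profile `depth_Q(z) − 1` (`depth_le_depth_add_one_of_norm_le`, `depthProfile_lipschitz`,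
  `depth_le_one_of_not_mem_cubeEdges`);
* `abs_kerInt_sub_le_of_agree_ball` — agreement form: if `ω = η` on every link off `Λ` within sup-distance `m` of the site
  `y` and `f` reads only links within sup-distance `ρ₀` of `y`, the two kernel means differ by `≤ 2M · #Δ · 2^{−(m+1−ρ₀)}`
  (ANY `Λ` — in particular the face-hugging sub-volumes `Q ∩ ball` the conditional covariance argument needs);
* `abs_kerE_sub_kerE_le_depthProfile` — depth form on cubes: for EVERY cube `Q = (c,b)` and ALL exteriors `η, η'`,
  `|kerE_{Q,η} f − kerE_{Q,η'} f| ≤ 2M · Σ_{z ∈ Δ} 2^{−(depth_Q(z) − 1)}` (a second, cell-free proof of the one-point rung,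
  now for observables spread over several sites: products `dens x · dens y`, the E2/E3 objects).

HONEST FRAMING.  Strong-coupling (high-temperature) lattice statements, every compact metrisable `G`, every lattice
representation; the engine of format rungs, not of the large-`β` clauses; nothing about NT, the seam or the gap.

References: R. L. Dobrushin, Theory Probab. Appl. 15 (1970) 458–486, Thm. 3; H. Föllmer, LNM 1362 (1988) Ch. I (2.10);
H.-O. Georgii, *Gibbs Measures and Phase Transitions* (2011) Thm. 8.20, Remark 8.26; B. Simon, CMP 68 (1979) 183 (the
one-site total-variation lemma).
-/

set_option autoImplicit false

noncomputable section

open MeasureTheory Filter Topology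
open Literature.MathematicalPhysics.QuantumFieldTheory Literature.MathematicalPhysics.QuantumLattice
open Literature.Probability.LatticeModels Literature.Probability.LatticeModels.DobrushinMetric
open Summit.QuantumFields.YangMills.Cruxes.OSLegsFromFemtoAndGap.DlrCollarTransfer
open Summit.Ventures.YMGap.StrongCouplingAllGroups (isKRContraction_ymSpecification_osc row_sum_le isLipBound_one_of_abs_le)

namespace Summit.QuantumFields.YangMills.Cruxes.NT.StrongCoupling

/-! ## §1 Profile super-solutions of Dobrushin's linear system -/

/-- **Profile super-solutions.**  If Dobrushin's matrix `C ≥ 0` has row sums `≤ α` over `nbr`, `α ≤ q ≤ 1`, `0 < q`, and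
`ℓ` is `1`-Lipschitz along the graph (`ℓ x ≤ ℓ z + 1` for `z ∈ nbr x`), then `d_z = q^{ℓ z}` satisfies
`Σ_{z ∈ nbr x} C_{xz} d_z ≤ d_x` (each term is `≤ C_{xz} q^{ℓ x − 1}`; Georgii 2011 Remark 8.26). [folklore] -/
theorem sum_mul_pow_profile_le {V : Type*} {nbr : V → Finset V} {C : V → V → ℝ} (hC0 : ∀ x z, 0 ≤ C x z)
    {α q : ℝ} (hq0 : 0 < q) (hq1 : q ≤ 1) (hαq : α ≤ q) (hrow : ∀ x, ∑ z ∈ nbr x, C x z ≤ α)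
    {ℓ : V → ℕ} (hℓ : ∀ x, ∀ z ∈ nbr x, ℓ x ≤ ℓ z + 1) (x : V) :
    ∑ z ∈ nbr x, C x z * q ^ ℓ z ≤ q ^ ℓ x := by
  have hα0 : 0 ≤ α := le_trans (Finset.sum_nonneg fun z _ => hC0 x z) (hrow x)
  have hterm : ∀ z ∈ nbr x, C x z * q ^ ℓ z ≤ C x z * q ^ (ℓ x - 1) := fun z hz =>
    mul_le_mul_of_nonneg_left (pow_le_pow_of_le_one hq0.le hq1 (by have := hℓ x z hz; omega)) (hC0 x z)
  calc ∑ z ∈ nbr x, C x z * q ^ ℓ z ≤ ∑ z ∈ nbr x, C x z * q ^ (ℓ x - 1) := Finset.sum_le_sum hterm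
    _ = (∑ z ∈ nbr x, C x z) * q ^ (ℓ x - 1) := (Finset.sum_mul _ _ _).symm
    _ ≤ α * q ^ (ℓ x - 1) := mul_le_mul_of_nonneg_right (hrow x) (pow_nonneg hq0.le _)
    _ ≤ q ^ ℓ x := by
        rcases Nat.eq_zero_or_pos (ℓ x) with h0 | hpos
        · rw [h0, Nat.zero_sub, pow_zero, mul_one]; exact hαq.trans hq1
        · obtain ⟨k, hk⟩ : ∃ k, ℓ x = k + 1 := ⟨ℓ x - 1, by omega⟩
          rw [hk, Nat.add_sub_cancel, pow_succ, mul_comm]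
          exact mul_le_mul_of_nonneg_left hαq (pow_nonneg hq0.le _)

/-! ## §2 Profiles on the links of `ℤ⁴`: the ball profile and the depth profile -/

/-- Plaquette neighbours move the integer part of the sup-distance to a fixed site by at most one. [folklore] -/
theorem floor_norm_le_of_mem_linkPlaqNbr {x z : Literature.MathematicalPhysics.QuantumLattice.ZdEdge 4}
    (hz : z ∈ linkPlaqNbr x) (y : Fin 4 → ℤ) : ⌊‖z.1 - y‖⌋₊ ≤ ⌊‖x.1 - y‖⌋₊ + 1 := by
  have h1 : ‖x.1 - z.1‖ ≤ (1 : ℝ) := norm_sub_le_one_of_mem_linkPlaqNbr hz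
  have h2 : ‖z.1 - y‖ ≤ ‖x.1 - y‖ + 1 := by
    calc ‖z.1 - y‖ ≤ ‖z.1 - x.1‖ + ‖x.1 - y‖ := norm_sub_le_norm_sub_add_norm_sub _ _ _
      _ ≤ 1 + ‖x.1 - y‖ := by rw [norm_sub_rev]; linarith
      _ = ‖x.1 - y‖ + 1 := add_comm _ _
  calc ⌊‖z.1 - y‖⌋₊ ≤ ⌊‖x.1 - y‖ + 1⌋₊ := Nat.floor_mono h2
    _ = ⌊‖x.1 - y‖⌋₊ + 1 := Nat.floor_add_one (norm_nonneg _)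

/-- **The ball profile is `1`-Lipschitz**: `ℓ(z) = (m + 1) − ⌊‖z − y‖_∞⌋` (natural subtraction). [folklore] -/
theorem ballProfile_lipschitz (y : Fin 4 → ℤ) (m : ℕ) (x : Literature.MathematicalPhysics.QuantumLattice.ZdEdge 4)
    (z : Literature.MathematicalPhysics.QuantumLattice.ZdEdge 4) (hz : z ∈ linkPlaqNbr x) :
    (m + 1 - ⌊‖x.1 - y‖⌋₊) ≤ (m + 1 - ⌊‖z.1 - y‖⌋₊) + 1 := by
  have h := floor_norm_le_of_mem_linkPlaqNbr hz y
  omega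

/-- Sup-norm `≤ 1` on `ℤ⁴` means every coordinate differs by at most one. [folklore] -/
theorem abs_sub_le_one_of_norm_le_one {u v : Fin 4 → ℤ} (h : ‖u - v‖ ≤ (1 : ℝ)) (k : Fin 4) : |u k - v k| ≤ 1 := by
  have hk := (pi_norm_le_iff_of_nonneg zero_le_one).1 h k
  rw [Pi.sub_apply, Int.norm_eq_abs, Int.cast_sub] at hk
  have : (|u k - v k| : ℤ) = |u k - v k| := rfl
  have h2 : ((|u k - v k| : ℤ) : ℝ) ≤ 1 := by push_cast; exact hk
  exact_mod_cast h2

/-- **A window of half-width `n` around `y` inside the cube forces depth `≥ n + 1`** (converse of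
`BoundaryLaw.window_of_succ_le_depth`). [folklore] -/
theorem succ_le_depth_of_window {c : Fin 4 → ℤ} {b : ℕ} {y : Fin 4 → ℤ} {n : ℕ}
    (h : ∀ j, c j + n ≤ y j ∧ y j + n + 1 ≤ c j + b) : n + 1 ≤ depth c b y := by
  unfold depth
  refine (Finset.le_inf'_iff _ _).2 fun j _ => ?_
  have hj := h j
  rw [le_min_iff]
  constructor <;> omega

/-- **The depth is `1`-Lipschitz** under moves of sup-norm `≤ 1`. [folklore] -/
theorem depth_le_depth_add_one_of_norm_le (c : Fin 4 → ℤ) (b : ℕ) {u v : Fin 4 → ℤ} (h : ‖u - v‖ ≤ (1 : ℝ)) :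
    depth c b u ≤ depth c b v + 1 := by
  rcases Nat.lt_or_ge (depth c b u) 2 with hlt | hge
  · omega
  · obtain ⟨n, hn⟩ : ∃ n : ℕ, depth c b u = n + 2 := ⟨depth c b u - 2, by omega⟩
    have hw := BoundaryLaw.window_of_succ_le_depth (c := c) (b := b) (y := u) (n := n + 1) (by rw [hn])
    have hv : n + 1 ≤ depth c b v := succ_le_depth_of_window fun j => by
      have h1 := hw j
      have h2 := abs_le.1 (abs_sub_le_one_of_norm_le_one h j)
      constructor <;> push_cast at h1 ⊢ <;> omega
    omega

/-- **The depth profile is `1`-Lipschitz along plaquette neighbours**: `ℓ(z) = depth_Q(z) − 1`. [folklore] -/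
theorem depthProfile_lipschitz (c : Fin 4 → ℤ) (b : ℕ) (x : Literature.MathematicalPhysics.QuantumLattice.ZdEdge 4)
    (z : Literature.MathematicalPhysics.QuantumLattice.ZdEdge 4) (hz : z ∈ linkPlaqNbr x) :
    depth c b x.1 - 1 ≤ (depth c b z.1 - 1) + 1 := by
  have h := depth_le_depth_add_one_of_norm_le c b (norm_sub_le_one_of_mem_linkPlaqNbr hz)
  omega

/-- **Links off the cube have depth `≤ 1`**: a link whose base point has depth `≥ 2` in `(c, b)` is an interior link
(`cubeEdges`), since both its endpoints lie in the cube. [folklore] -/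
theorem depth_le_one_of_not_mem_cubeEdges {c : Fin 4 → ℤ} {b : ℕ}
    {z : Literature.MathematicalPhysics.QuantumLattice.ZdEdge 4} (hz : z ∉ cubeEdges c b) : depth c b z.1 ≤ 1 := by
  by_contra hlt
  have h2 : (1 : ℕ) + 1 ≤ depth c b z.1 := by omega
  have hw := BoundaryLaw.window_of_succ_le_depth h2
  apply hz
  simp only [cubeEdges, Finset.mem_filter, Finset.mem_product, Finset.mem_univ, and_true, cubeSites,
    Fintype.mem_piFinset, Finset.mem_Ico, Pi.add_apply]
  refine ⟨fun j => ?_, fun j => ?_⟩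
  · have hj := hw j; constructor <;> push_cast at hj ⊢ <;> omega
  · have hj := hw j
    have hs : (Pi.single z.2 (1 : ℤ) : Fin 4 → ℤ) j = 0 ∨ (Pi.single z.2 (1 : ℤ) : Fin 4 → ℤ) j = 1 := by
      rcases eq_or_ne j z.2 with h' | h'
      · subst h'; exact Or.inr (by simp)
      · exact Or.inl (by simp [Pi.single_eq_of_ne h'])
    rcases hs with hs | hs <;> rw [hs] <;> constructor <;> push_cast at hj ⊢ <;> omega

/-! ## §3 General-volume influence at strong coupling -/

section Main

variable (G : Type) [Group G] [TopologicalSpace G] [IsTopologicalGroup G] [CompactSpace G]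
  [MeasurableSpace G] [BorelSpace G] (r : LatticeRep G)

/-- **Boundary influence on an ARBITRARY finite volume at strong coupling, profile form.**  Let `r` be a lattice
representation (dimension `N`) of a compact metrisable `G` and `216 · N · |β| ≤ 1`, so that the total-variation Dobrushin
matrix of the Wilson specification (`6 N |β|` per plaquette neighbour, `isKRContraction_ymSpecification_osc`) has row sums
`≤ 108 N |β| ≤ 1/2`.  Then for EVERY finite link set `Λ`, every two exteriors `ω, η`, every profile `ℓ : links → ℕ` that
is `1`-Lipschitz along plaquette neighbours and VANISHES at every link off `Λ` where `ω ≠ η`, and every bounded measurable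
observable `f` (`|f| ≤ M`) depending on the finite link set `Δ`:
`|∫ f dγ_Λ(·|ω) − ∫ f dγ_Λ(·|η)| ≤ 2M · Σ_{z ∈ Δ} 2^{−ℓ z}` (Georgii 2011 Thm. 8.20 with the super-solution `2^{−ℓ}` of
`sum_mul_pow_profile_le` and the discrete weight). [folklore] -/
theorem abs_kerInt_sub_le_of_profile {β : ℝ} (hβ : 216 * (r.N : ℝ) * |β| ≤ 1)
    (Λ : Finset (Literature.MathematicalPhysics.QuantumLattice.ZdEdge 4)) (ω η : LGConfig 4 G)
    (ℓ : Literature.MathematicalPhysics.QuantumLattice.ZdEdge 4 → ℕ)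
    (hℓ : ∀ x, ∀ z ∈ linkPlaqNbr x, ℓ x ≤ ℓ z + 1) (hℓ0 : ∀ z, z ∉ Λ → ω z ≠ η z → ℓ z = 0)
    {f : LGConfig 4 G → ℝ} (hfm : Measurable f) {Δ : Finset (Literature.MathematicalPhysics.QuantumLattice.ZdEdge 4)}
    (hdep : DependsOn f (↑Δ : Set (Literature.MathematicalPhysics.QuantumLattice.ZdEdge 4))) {M : ℝ}
    (hM : ∀ U, |f U| ≤ M) :
    |(∫ U, f U ∂(ymSpecification (d := 4) r.ρ β Λ ω)) - ∫ U, f U ∂(ymSpecification (d := 4) r.ρ β Λ η)| ≤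
      2 * M * ∑ z ∈ Δ, (1 / 2 : ℝ) ^ ℓ z := by
  classical
  haveI := r.t2Space
  haveI := r.secondCountableTopology
  have hγ := BoundaryLaw.isSpecification_cubeKernels G r β
  have hKR := isKRContraction_ymSpecification_osc (d := 4) r.ρ r.continuous (Nat.cast_nonneg r.N)
    (abs_plaquetteObs_le_holds r.ρ r.mem_unitary) β
  have hM0 : 0 ≤ M := (abs_nonneg _).trans (hM fun _ => 1)
  -- row sums `≤ 108 N |β| ≤ 1/2`
  set α : ℝ := 12 * ((4 - 1 : ℕ) : ℝ) ^ 2 * (r.N : ℝ) * |β| with hα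
  have hrow : ∀ x : Literature.MathematicalPhysics.QuantumLattice.ZdEdge 4,
      ∑ _y ∈ linkPlaqNbr x, ((2 * (4 - 1 : ℕ) : ℕ) : ℝ) * (r.N : ℝ) * |β| ≤ α := fun x =>
    row_sum_le (d := 4) (Nat.cast_nonneg r.N) x
  have hα2 : α ≤ 1 / 2 := by
    rw [hα]; push_cast; nlinarith [abs_nonneg β, (Nat.cast_nonneg r.N : (0 : ℝ) ≤ r.N)]
  have hα0 : 0 ≤ α := by rw [hα]; positivity
  have hcoef0 : ∀ x z : Literature.MathematicalPhysics.QuantumLattice.ZdEdge 4,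
      (0 : ℝ) ≤ ((2 * (4 - 1 : ℕ) : ℕ) : ℝ) * (r.N : ℝ) * |β| := fun _ _ => by positivity
  -- the super-solution `2^{-ℓ}`
  have hsol := fun x (_ : x ∈ Λ) => sum_mul_pow_profile_le (nbr := linkPlaqNbr)
    (C := fun _ _ => ((2 * (4 - 1 : ℕ) : ℕ) : ℝ) * (r.N : ℝ) * |β|) hcoef0 (q := 1 / 2) (by norm_num) (by norm_num)
    hα2 hrow hℓ x
  have hrowW : ∀ x ∈ Λ, ∑ z ∈ linkPlaqNbr x,
      (if z ∈ Λ then ((2 * (4 - 1 : ℕ) : ℕ) : ℝ) * (r.N : ℝ) * |β| else 0) ≤ α := fun x _ =>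
    (Finset.sum_le_sum fun z _ => by split_ifs <;> first | exact le_rfl | exact hcoef0 x z).trans (hrow x)
  have key := abs_kernel_sub_le_of_superSolution_of_ne hγ hKR (fun _ _ => zero_le_one) (fun _ _ => le_rfl)
    zero_le_one Λ ω η (d := fun z => (1 / 2 : ℝ) ^ ℓ z) (fun z => by positivity)
    (fun z hz hne => by rw [hℓ0 z hz hne, pow_zero]) hsol hα0 (by linarith) hrowW hfm hdep hM
    (isLipBound_one_of_abs_le hM hdep)
  refine key.trans (le_of_eq ?_)
  rw [one_mul, Finset.mul_sum]
  exact Finset.sum_congr rfl fun z hz => by rw [if_pos hz]; ring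

/-- **Agreement form, ball profile.**  With `216 N |β| ≤ 1`: if the exteriors `ω, η` agree on every link OFF `Λ` whose base
point is within sup-distance `m` of the site `y` (integer part), and `f` reads only links based within sup-distance `ρ₀` of
`y`, then `|∫ f dγ_Λ(·|ω) − ∫ f dγ_Λ(·|η)| ≤ 2M · #Δ · 2^{−(m + 1 − ρ₀)}` — for ANY finite `Λ` (no shape condition).
[folklore] -/
theorem abs_kerInt_sub_le_of_agree_ball {β : ℝ} (hβ : 216 * (r.N : ℝ) * |β| ≤ 1)
    (Λ : Finset (Literature.MathematicalPhysics.QuantumLattice.ZdEdge 4)) (ω η : LGConfig 4 G) (y : Fin 4 → ℤ)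
    (m : ℕ) (hagree : ∀ z, z ∉ Λ → ⌊‖z.1 - y‖⌋₊ ≤ m → ω z = η z)
    {f : LGConfig 4 G → ℝ} (hfm : Measurable f) {Δ : Finset (Literature.MathematicalPhysics.QuantumLattice.ZdEdge 4)}
    (hdep : DependsOn f (↑Δ : Set (Literature.MathematicalPhysics.QuantumLattice.ZdEdge 4))) {M : ℝ}
    (hM : ∀ U, |f U| ≤ M) {ρ₀ : ℕ} (hΔ : ∀ z ∈ Δ, ⌊‖z.1 - y‖⌋₊ ≤ ρ₀) :
    |(∫ U, f U ∂(ymSpecification (d := 4) r.ρ β Λ ω)) - ∫ U, f U ∂(ymSpecification (d := 4) r.ρ β Λ η)| ≤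
      2 * M * Δ.card * (1 / 2 : ℝ) ^ (m + 1 - ρ₀) := by
  have hM0 : 0 ≤ M := (abs_nonneg _).trans (hM fun _ => 1)
  have h := abs_kerInt_sub_le_of_profile G r hβ Λ ω η (fun z => m + 1 - ⌊‖z.1 - y‖⌋₊)
    (fun x z hz => ballProfile_lipschitz y m x z hz)
    (fun z hz hne => by
      have : ¬ (⌊‖z.1 - y‖⌋₊ ≤ m) := fun hle => hne (hagree z hz hle)
      omega) hfm hdep hM
  refine h.trans ?_
  have hsum : ∑ z ∈ Δ, (1 / 2 : ℝ) ^ (m + 1 - ⌊‖z.1 - y‖⌋₊) ≤ ∑ _z ∈ Δ, (1 / 2 : ℝ) ^ (m + 1 - ρ₀) :=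
    Finset.sum_le_sum fun z hz => pow_le_pow_of_le_one (by norm_num) (by norm_num) (by have := hΔ z hz; omega)
  rw [Finset.sum_const, nsmul_eq_mul] at hsum
  calc 2 * M * ∑ z ∈ Δ, (1 / 2 : ℝ) ^ (m + 1 - ⌊‖z.1 - y‖⌋₊) ≤ 2 * M * (Δ.card * (1 / 2 : ℝ) ^ (m + 1 - ρ₀)) :=
        mul_le_mul_of_nonneg_left hsum (by positivity)
    _ = 2 * M * Δ.card * (1 / 2 : ℝ) ^ (m + 1 - ρ₀) := by ring

/-- **Depth form on cubes.**  With `216 N |β| ≤ 1`: for EVERY cube `Q = (c, b)`, ALL exteriors `η, η'` and every bounded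
measurable `f` (`|f| ≤ M`) depending on `Δ`: `|kerE_{Q,η} f − kerE_{Q,η'} f| ≤ 2M · Σ_{z ∈ Δ} 2^{−(depth_Q(z) − 1)}`
(links off `Q` have depth `≤ 1`, so the depth profile vanishes wherever the exteriors can differ). [folklore] -/
theorem abs_kerE_sub_kerE_le_depthProfile {β : ℝ} (hβ : 216 * (r.N : ℝ) * |β| ≤ 1) (c : Fin 4 → ℤ) (b : ℕ)
    (η η' : LGConfig 4 G) {f : LGConfig 4 G → ℝ} (hfm : Measurable f)
    {Δ : Finset (Literature.MathematicalPhysics.QuantumLattice.ZdEdge 4)}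
    (hdep : DependsOn f (↑Δ : Set (Literature.MathematicalPhysics.QuantumLattice.ZdEdge 4))) {M : ℝ}
    (hM : ∀ U, |f U| ≤ M) :
    |kerE G r β c b η f - kerE G r β c b η' f| ≤ 2 * M * ∑ z ∈ Δ, (1 / 2 : ℝ) ^ (depth c b z.1 - 1) := by
  unfold kerE
  exact abs_kerInt_sub_le_of_profile G r hβ (cubeEdges c b) η η' (fun z => depth c b z.1 - 1)
    (fun x z hz => depthProfile_lipschitz c b x z hz)
    (fun z hz _ => by have := depth_le_one_of_not_mem_cubeEdges hz; omega) hfm hdep hM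

end Main

end Summit.QuantumFields.YangMills.Cruxes.NT.StrongCoupling

end
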